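import Summits.AtomisticToContinuum.Crystallization.Theorems.PricedLinkCensusLocalToGlobalNewtonShell8
import Summits.AtomisticToContinuum.Crystallization.Theorems.PricedLinkCensusLocalToGlobalConfinedThomson
import Summits.AtomisticToContinuum.Crystallization.Theorems.PricedLinkCensusLocalToGlobalFccMirrorExact
import Summits.AtomisticToContinuum.Crystallization.Theorems.ChargedEnergyGap.Negative.PeriodicMinimisers

/-!
# Crux `LocalToGlobal` (stmt-AtomisticToContinuum-14232): the fold into the sibling crux `ChargedEnergyGap`

`LocalToGlobal` is the material implication `TruncatedCensusGap → ChargedEnergyGap` between the two open sibling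
cruxes of route `PricedLinkCensus` (items 14230, 14231).  This file records, as importable Theorems-side lemmas,
the bookkeeping by which the crux is FOLDED into `ChargedEnergyGap` (stmt-AtomisticToContinuum-14231):

* `localToGlobal_of_chargedEnergyGap : ChargedEnergyGap → LocalToGlobal` — the moment item 14231 closes, this crux
  closes by this one line (release `--by` a proof of `LocalToGlobal` obtained from it);
* `localToGlobal_iff_chargedEnergyGap : TruncatedCensusGap → (LocalToGlobal ↔ ChargedEnergyGap)` — under the
  antecedent the two cruxes are the same statement; `localToGlobal_iff_not_or` is the classical reading;
* `localToGlobal_of_kappaMax_pos : 0 < kappaMax (1/100) → LocalToGlobal` — via 14231's certified reformulation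
  `chargedEnergyGap_iff_kappaMax_pos` (Theorems/ChargedEnergyGap/Negative/PeriodicMinimisers): the crux follows from the
  strict positivity of ONE variational constant, the admissible price
  `κ_max(1/100) = ⨅ (E_LJ(y) − N·e*)/#charged(y)`;
* conversely the ONE open stub of the picked line `flux-cell-joint-census`
  (`stub_fluxCellPricedGap : FccMirrorExact → FluxCellPricedGap`, skeleton
  `Cruxes/LocalToGlobal/Lines/flux_cell_joint_census.lean`) asserts that positivity:
  `kappaMax_pos_of_fluxCellPricedGap`, `kappaMax_pos_of_stub_fluxCellPricedGap` — it is at least 14231-sized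
  (in fact stronger: a priced gap for the LOCAL functional `Σᵢ λᵢ ≤ E_LJ`).

Why the antecedent is not consumed: every consumption of `TruncatedCensusGap` with a configuration-uniform constant
is dead (crux workfile `Cruxes/LocalToGlobal/Disproof.lean`: D1 additive split / `not_tailDominance`, BN2
δ₀-saturation at the Lennard-Jones minimiser, D2 own-scale shell counting, §4 twist walls; triage r1-1/2/3), and a
refutation of it needs a sharp lower bound on the periodic infimum `e_χ*`.  All `[folklore]` (compositions of landed
results).
-/

noncomputable section

namespace Summit.AtomisticToContinuum.Crystallization.Theorems.PricedLinkCensusLocalToGlobal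

open Summit.AtomisticToContinuum.Crystallization.Theses.PricedLinkCensus
open Summit.AtomisticToContinuum.Crystallization.Theorems.ChargedEnergyGapNegative

/-- **The fold**: the sibling crux `ChargedEnergyGap` (stmt-AtomisticToContinuum-14231) proves this crux
`LocalToGlobal` (stmt-AtomisticToContinuum-14232) in one line — the antecedent `TruncatedCensusGap` is simply
discarded. [folklore] -/
theorem localToGlobal_of_chargedEnergyGap : ChargedEnergyGap → LocalToGlobal := fun h _ => h

/-- Under the antecedent `TruncatedCensusGap` (stmt-AtomisticToContinuum-14230) the two cruxes `LocalToGlobal` and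
`ChargedEnergyGap` are EQUIVALENT. [folklore] -/
theorem localToGlobal_iff_chargedEnergyGap (hT : TruncatedCensusGap) : LocalToGlobal ↔ ChargedEnergyGap :=
  ⟨fun h => h hT, fun h _ => h⟩

/-- Classical reading of the crux: `LocalToGlobal` holds iff the antecedent fails or the consequent holds; a proof
therefore either refutes `TruncatedCensusGap` or proves `ChargedEnergyGap` on the instances it needs. [folklore] -/
theorem localToGlobal_iff_not_or : LocalToGlobal ↔ (¬ TruncatedCensusGap ∨ ChargedEnergyGap) :=
  imp_iff_not_or

/-- **The crux from one number**: strict positivity of the admissible price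
`κ_max(1/100) = ⨅_y (E_LJ(y) − N·e*)/#charged(y)` (14231's certified reformulation
`chargedEnergyGap_iff_kappaMax_pos`) proves `LocalToGlobal`. [folklore] -/
theorem localToGlobal_of_kappaMax_pos (h : 0 < kappaMax (1 / 100)) : LocalToGlobal :=
  localToGlobal_of_chargedEnergyGap (chargedEnergyGap_iff_kappaMax_pos.2 h)

/-- Conversely the flux-cell priced gap — the statement of the picked line's one open stub — asserts that
positivity (through the Defs-file composition `chargedEnergyGap_of` with the landed `stub_newtonShell8`, `stub_confinedThomson`; cf. `chargedEnergyGap_of_fluxCellPricedGap`, p114594): the stub carries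
the whole energetic content of the sibling crux. [folklore] -/
theorem kappaMax_pos_of_fluxCellPricedGap (h : FluxCellPricedGap) : 0 < kappaMax (1 / 100) :=
  chargedEnergyGap_iff_kappaMax_pos.1 (chargedEnergyGap_of stub_newtonShell8 stub_confinedThomson h)

/-- The same for the registered form `FccMirrorExact → FluxCellPricedGap` of the open stub (its hypothesis is the
landed theorem `stub_fccMirrorExact stub_newtonShell8`, cf. `fccMirrorExact_holds` p114594). [folklore] -/
theorem kappaMax_pos_of_stub_fluxCellPricedGap (h : FccMirrorExact → FluxCellPricedGap) :
    0 < kappaMax (1 / 100) :=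
  kappaMax_pos_of_fluxCellPricedGap (h (stub_fccMirrorExact stub_newtonShell8))

/-- Hence the open stub and the sibling crux stand or fall together as far as THIS crux is concerned:
`(FccMirrorExact → FluxCellPricedGap) → LocalToGlobal` factors through `0 < κ_max(1/100)`, i.e. through
`ChargedEnergyGap`. [folklore] -/
theorem localToGlobal_of_stub_fluxCellPricedGap (h : FccMirrorExact → FluxCellPricedGap) : LocalToGlobal :=
  localToGlobal_of_kappaMax_pos (kappaMax_pos_of_stub_fluxCellPricedGap h)

end Summit.AtomisticToContinuum.Crystallization.Theorems.PricedLinkCensusLocalToGlobal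

end
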